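import Summits.ValiantsHypothesis.ValiantsHypothesis.Theorems.SymPencilPerFourInnerRankRows

/-!
# Route `SymPencil` — inner rank of the `2 | 2` row split of `per_4`: kernel vectors from a
# radical pair, at most NINE squares (`--supports` stmt-ValiantsHypothesis-5674 `SdcSuperquadratic`;
# toward "inner rank `≥ 10`", the cell `(8, 8, 9)` of the size `m = 26`; rung currency only)

One linear-algebra lemma, the new ingredient of the nine-square version of the inner-rank bound
(`SymPencilPerFourInnerRankTenFamily`, `…TenPairs`, `…Ten`): let `t_r(u, ·)` (`r ∈ ι`, `|ι| ≤ 9`)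
be linear forms on the `8`-dimensional `y`-space `K⁴ × K⁴` and `c_r ≠ 0`.  If for some `k ≠ 0`
both `(k, 0)` and `(0, k)` are radical vectors of the pairing `Σ_r c_r t_r(u, y) t_r(u, y')`, then
the forms have a common non-trivial zero.  Otherwise `y ↦ (t_r(u,y))_r` is injective with
`8`-dimensional image in `K^ι`, annihilated by the functional pair
`x ↦ (Σ c_r t_r(u,(k,0)) x_r, Σ c_r t_r(u,(0,k)) x_r)`, which is onto `K²` because the two
coefficient vectors are linearly independent (a dependence would put `(l k, m k)` in the kernel);
so `8 ≤ |ι| - 2 ≤ 7`.  (For `|ι| = 8` this is the surjectivity argument of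
`SymPencilPerFourInnerRankFamily.family_step`; at `|ι| = 10` it fails, as it must: there the
image can be an `8`-space with `2`-dimensional radical.)

Honest framing: a lemma; `sdc(per_4) ≥ 25` unchanged; the crux `SdcSuperquadratic` and
`VP ≠ VNP` untouched.  No definitions, no named facts. [folklore]
-/

noncomputable section

-- single-conjunct layout: Sub = Summit, duplicated namespace component intended
set_option linter.dupNamespace false

namespace Summit.ValiantsHypothesis.ValiantsHypothesis.Theorems.SymPencilPerFourInnerRankKernel

open Matrix Finset Module

variable {K : Type*} [Field K] {ι : Type*} [Fintype ι]

/-! ### A kernel vector from a radical pair (at most nine squares) -/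

/-- **Kernel vectors from radical vectors.**  Let `t_r(u, ·)` (`r ∈ ι`, `|ι| ≤ 9`) be linear forms
on the `8`-dimensional `y`-space and `c_r ≠ 0`.  If for some `k ≠ 0` both `(k, 0)` and `(0, k)`
are radical vectors of the pairing `Σ_r c_r t_r(u, y) t_r(u, y')`, then the forms have a common
non-trivial zero: otherwise `y ↦ (t_r(u,y))_r` is injective with `8`-dimensional image, and the two
independent vectors `(c_r t_r(u,(k,0)))_r`, `(c_r t_r(u,(0,k)))_r` are dot-orthogonal to it inside
`K^ι`, forcing `8 ≤ |ι| - 2 ≤ 7`. [folklore] -/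
theorem ker_ne_bot_of_radical_pair [DecidableEq ι] (hι : Fintype.card ι ≤ 9) (c : ι → K) (hc : ∀ r, c r ≠ 0)
    (t : ι → (((Fin 4 → K) × (Fin 4 → K)) →ₗ[K] ((Fin 4 → K) × (Fin 4 → K)) →ₗ[K] K))
    (u : (Fin 4 → K) × (Fin 4 → K)) (k : Fin 4 → K) (hk : k ≠ 0)
    (hrad : ∀ y', ∑ r, c r * t r u (k, 0) * t r u y' = 0)
    (hrad' : ∀ y', ∑ r, c r * t r u (0, k) * t r u y' = 0) :
    LinearMap.ker (LinearMap.pi fun r => t r u) ≠ ⊥ := by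
  set Tu : ((Fin 4 → K) × (Fin 4 → K)) →ₗ[K] (ι → K) := LinearMap.pi fun r => t r u with hTu_def
  have hTu : ∀ y r, Tu y r = t r u y := fun y r => rfl
  intro hbot
  have hinj : Function.Injective Tu := LinearMap.ker_eq_bot.1 hbot
  -- the two radical vectors, as vectors of `K^ι`
  set v₁ : ι → K := fun r => c r * t r u (k, 0) with hv₁
  set v₂ : ι → K := fun r => c r * t r u (0, k) with hv₂
  -- the functional pair `Φ x = (v₁ · x, v₂ · x)` kills the image of `Tu`
  let Φ : (ι → K) →ₗ[K] (K × K) :=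
    { toFun := fun x => (∑ r, v₁ r * x r, ∑ r, v₂ r * x r)
      map_add' := fun x y => by
        simp only [Pi.add_apply, mul_add, Finset.sum_add_distrib, Prod.mk_add_mk]
      map_smul' := fun s x => by
        simp only [Pi.smul_apply, smul_eq_mul, RingHom.id_apply, Prod.smul_mk, Finset.mul_sum]
        congr 1 <;> exact Finset.sum_congr rfl fun r _ => by ring }
  have hΦ : ∀ x, Φ x = (∑ r, v₁ r * x r, ∑ r, v₂ r * x r) := fun x => rfl
  have himage : LinearMap.range Tu ≤ LinearMap.ker Φ := by
    rintro _ ⟨y', rfl⟩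
    rw [LinearMap.mem_ker, hΦ, Prod.mk_eq_zero]
    refine ⟨?_, ?_⟩
    · rw [← hrad y']; exact Finset.sum_congr rfl fun r _ => by rw [hTu]
    · rw [← hrad' y']; exact Finset.sum_congr rfl fun r _ => by rw [hTu]
  -- `range Φ` is `2`-dimensional: it contains `Φ e_r = (v₁ r, v₂ r)` for every `r`, and `v₁, v₂`
  -- are linearly independent
  have hindep : ∀ l m : K, (∀ r, l * v₁ r + m * v₂ r = 0) → l = 0 ∧ m = 0 := by
    intro l m h
    have hz : Tu (l • (k, (0 : Fin 4 → K)) + m • ((0 : Fin 4 → K), k)) = 0 := by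
      funext r
      rw [hTu, map_add, map_smul, map_smul, smul_eq_mul, smul_eq_mul, Pi.zero_apply]
      have h' := h r
      simp only [hv₁, hv₂] at h'
      have : c r * (l * t r u (k, 0) + m * t r u (0, k)) = 0 := by linear_combination h'
      exact (mul_eq_zero.1 this).resolve_left (hc r)
    have h0 := hinj (hz.trans (map_zero Tu).symm)
    rw [Prod.ext_iff] at h0
    simp only [Prod.fst_add, Prod.snd_add, Prod.smul_fst, Prod.smul_snd, smul_zero, add_zero,
      zero_add, Prod.fst_zero, Prod.snd_zero, smul_eq_zero] at h0
    exact ⟨h0.1.resolve_right hk, h0.2.resolve_right hk⟩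
  have hrange : LinearMap.range Φ = ⊤ := by
    -- if not, `range Φ` has dimension `≤ 1`, so all `(v₁ r, v₂ r)` are multiples of one vector
    by_contra hne
    have hlt : finrank K (LinearMap.range Φ) < 2 := by
      have h := Submodule.finrank_lt hne
      rw [finrank_prod, finrank_self] at h
      exact h
    have hle : finrank K (LinearMap.range Φ) ≤ 1 := by omega
    obtain ⟨g, hg⟩ := finrank_le_one_iff.1 hle
    -- `g = (g₁, g₂)`; every `(v₁ r, v₂ r)` is a multiple of it
    have hmem : ∀ r, ∃ s : K, s • (g : K × K) = (v₁ r, v₂ r) := fun r => by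
      have hr : (v₁ r, v₂ r) ∈ LinearMap.range Φ := ⟨Pi.single r 1, by
        rw [hΦ]
        simp only [Pi.single_apply, mul_ite, mul_one, mul_zero, Finset.sum_ite_eq',
          Finset.mem_univ, if_true]⟩
      obtain ⟨s, hs⟩ := hg ⟨_, hr⟩
      exact ⟨s, by rw [← Submodule.coe_smul, hs]⟩
    -- then `g₂ v₁ - g₁ v₂ = 0`
    have hdep : ∀ r, (g : K × K).2 * v₁ r + (-(g : K × K).1) * v₂ r = 0 := fun r => by
      obtain ⟨s, hs⟩ := hmem r
      simp only [Prod.ext_iff, Prod.smul_fst, Prod.smul_snd, smul_eq_mul] at hs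
      rw [← hs.1, ← hs.2]; ring
    obtain ⟨h2, h1⟩ := hindep _ _ hdep
    rw [neg_eq_zero] at h1
    have hg0 : (g : K × K) = 0 := Prod.ext h1 h2
    -- so `v₁ = 0`, contradicting `hindep` with `(l, m) = (1, 0)`
    have hv : ∀ r, (1 : K) * v₁ r + 0 * v₂ r = 0 := fun r => by
      obtain ⟨s, hs⟩ := hmem r
      simp only [hg0, smul_zero, Prod.ext_iff, Prod.fst_zero, Prod.snd_zero] at hs
      rw [← hs.1]; simp
    exact one_ne_zero (hindep 1 0 hv).1
  -- dimension count: `8 = dim range Tu ≤ dim ker Φ = |ι| - 2 ≤ 7`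
  have hkerΦ : finrank K (LinearMap.ker Φ) + 2 = Fintype.card ι := by
    have h := LinearMap.finrank_range_add_finrank_ker Φ
    rw [hrange, finrank_top, finrank_prod, finrank_self, finrank_fintype_fun_eq_card] at h
    omega
  have hrangeTu : finrank K (LinearMap.range Tu) = 8 := by
    have h := LinearMap.finrank_range_of_inj hinj
    rw [h, finrank_prod, finrank_fintype_fun_eq_card, Fintype.card_fin]
  have h8 := Submodule.finrank_mono himage
  rw [hrangeTu] at h8
  omega

end Summit.ValiantsHypothesis.ValiantsHypothesis.Theorems.SymPencilPerFourInnerRankKernel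

end
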